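import Mathlib
import Summits.Ventures.PercRepro2.HCov
import Summits.Ventures.PercRepro2.RootLeafUTheorem
import Summits.Ventures.PercRepro2.GcSeries
import Summits.Ventures.PercRepro2.RootLeafUCoinThm

/-!
# (G4-u), the coin class through a series vertex: `T2` is invariant under contracting an unmarked
degree-2 vertex, so «`b – x – root`» with `x` unmarked of degree 2 is the coin class
(blind cell PercRepro2, p4 g15; S3 (G4-u) item (ab) addendum; no definitions)

* **`T2_transport_marks`**: the transport lemma of GcTransportMarks for the second coefficient `T2` of the
  root-leaf cubic — `T2` is a polynomial in probabilities of events built from connections among the five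
  marks `o, u, a₂, c, b` of the smaller instance, so a configuration map `Ψ` with `P_q(A) = P_p(Ψ⁻¹ A)`
  transporting connectivity on the marks carries `T2 q ends` to `T2 p ends'`;
* **`T2_series`**: the series rule — if the unmarked `y` carries exactly the two non-loop edges
  `e = {r, y}`, `f = {y, w}`, then `T2` of `G` is `T2` of `G/e` (`f` becomes `{r, w}`, `e` a loop) with the
  weights `p[f ↦ p_e · p_f][e ↦ 0]` (`RECM.conn_series_iff` + `RECM.prob_series_pushforward`, for ANY
  vertex `r`, marked or not);
* **`HCov_root_leaf_u_of_coin_series_u`** / **`…_series_a2`**: (G4-u) — (HCOV) at `(o, a₁, a₂, c, b)` for `a₁`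
  pendant at the unmarked `u` from (HCOV) at `(o, u, a₂, c, b)` — when `b` carries exactly the edges
  `{b, a₂}` and `{b, x}` with `x` unmarked of degree 2 adjacent to `u` (resp. `{b, u}` and `{b, x}` with `x`
  adjacent to `a₂`): contracting `x` into the root gives the coin class of RootLeafUCoinThm.  These are the
  96 one-step series lines of the D368 harvest (84 + 12, own count).
-/

namespace Summit.Ventures.PercRepro2

open UnionCluster CovForm Contract RECM

namespace RootLeafU

namespace Coin

section Transport

variable {V : Type*} {E : Type*} [Fintype E] [DecidableEq E] [DecidableEq V] {R : Type*}
  [Field R] [LinearOrder R]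

omit [DecidableEq V] [LinearOrder R] in
/-- **Transport of `T2` on the marks**: `P_q(A) = P_p(Ψ⁻¹ A)` for every event and `Ψ`, `φ` transport
connectivity between the five marks of the smaller instance ⟹ `T2` is carried along. -/
theorem T2_transport_marks {q p : E → R} {ends ends' : E → Sym2 V} {Ψ : Config E → Config E}
    {φ : V → V} (hP : ∀ A : Set (Config E), prob q A = prob p (Ψ ⁻¹' A)) (o a₂ c b u : V)
    (hH : ∀ ω, ∀ x ∈ ({o, u, a₂, c, b} : Set V), ∀ z ∈ ({o, u, a₂, c, b} : Set V),
      Conn ends (Ψ ω) x z ↔ Conn ends' ω (φ x) (φ z)) :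
    T2 q ends o a₂ c b u = T2 p ends' (φ o) (φ a₂) (φ c) (φ b) (φ u) := by
  have ho : o ∈ ({o, u, a₂, c, b} : Set V) := by simp
  have hu : u ∈ ({o, u, a₂, c, b} : Set V) := by simp
  have h2 : a₂ ∈ ({o, u, a₂, c, b} : Set V) := by simp
  have hc : c ∈ ({o, u, a₂, c, b} : Set V) := by simp
  have hb : b ∈ ({o, u, a₂, c, b} : Set V) := by simp
  simp only [T2, Do, gap, EQbo, EQb3, EQb3o, EQo, EQ3, EQ3o, PDb, PDbo, hP, Set.preimage_inter,
    Set.preimage_univ, preimage_PDEvent_of_mem hH hu h2 hc, preimage_TEvent_of_mem hH hu h2 hc,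
    preimage_TEvent_of_mem hH h2 hu hc, preimage_connEvent_of_mem hH h2 ho,
    preimage_connEvent_of_mem hH h2 hb, preimage_connEvent_of_mem hH h2 hc,
    preimage_connEvent_of_mem hH hu ho, preimage_connEvent_of_mem hH hu hb,
    preimage_avoidAll_singleton_of_mem hH h2 hu,
    preimage_avoidAll_singleton_of_mem hH h2 hc]

omit [Fintype E] [DecidableEq E] [DecidableEq V] in
/-- A vertex different from the five marks is not in the mark set. -/
lemma ne_of_mem_five {o a₂ c b u y x : V} (hyo : y ≠ o) (hyu : y ≠ u) (hy2 : y ≠ a₂) (hyc : y ≠ c)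
    (hyb : y ≠ b) (hx : x ∈ ({o, u, a₂, c, b} : Set V)) : x ≠ y := by
  simp only [Set.mem_insert_iff, Set.mem_singleton_iff] at hx
  rcases hx with rfl | rfl | rfl | rfl | rfl
  · exact hyo.symm
  · exact hyu.symm
  · exact hy2.symm
  · exact hyc.symm
  · exact hyb.symm

omit [LinearOrder R] in
/-- **The series rule for `T2`**: if the unmarked `y` has exactly the two non-loop edges `e = {r, y}` and
`f = {y, w}`, then `T2` of `G` is `T2` of `G/e` (`f` has become `{r, w}`, `e` a loop) with the weights
`p[f ↦ p_e · p_f][e ↦ 0]` — for any vertex `r`. -/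
theorem T2_series (p : E → R) {ends : E → Sym2 V} {e f : E} {o a₂ c b u r y w : V}
    (hg : ends e = s(r, y)) (hf : ends f = s(y, w)) (hef : e ≠ f) (hry : r ≠ y) (hyw : y ≠ w)
    (hyo : y ≠ o) (hyu : y ≠ u) (hy2 : y ≠ a₂) (hyc : y ≠ c) (hyb : y ≠ b)
    (hdeg : ∀ g, g ≠ e → g ≠ f → y ∈ ends g → (ends g).IsDiag) :
    T2 p ends o a₂ c b u =
      T2 (Function.update (Function.update p f (p e * p f)) e 0) (contractRootEdge ends r y) o a₂ c b u :=
  (T2_transport_marks (φ := id) (prob_series_pushforward p hef) o a₂ c b u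
    (fun ω _ hx _ hz => conn_series_iff hg hf hef hry hyw hdeg ω
      (ne_of_mem_five hyo hyu hy2 hyc hyb hx) (ne_of_mem_five hyo hyu hy2 hyc hyb hz))).symm

end Transport

section Contract

variable {V : Type*} {E : Type*} [DecidableEq V]

omit [DecidableEq V] in
/-- `x ∉ s(a, b)` when `x ≠ a, b`. -/
lemma notMem_mk_of_ne {x a b : V} (ha : x ≠ a) (hb : x ≠ b) : x ∉ s(a, b) := by
  simp [Sym2.mem_iff, ha, hb]

/-- The contracted edge `f = {y, w}` at the root `r` becomes `{r, w}`. -/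
lemma contractRootEdge_eq_of_eq {ends : E → Sym2 V} {f : E} {r y w : V} (hf : ends f = s(y, w))
    (hwr : w ≠ r) (hwy : w ≠ y) : contractRootEdge ends r y f = s(r, w) := by
  rw [contractRootEdge, contractEnds_apply, hf, Sym2.map_mk,
    contractMap_of_mem (Finset.mem_insert_of_mem (Finset.mem_singleton_self y)),
    contractMap_of_notMem (by simp [hwr, hwy])]

/-- A vertex `b ∉ {r, y}` lies on a contracted edge iff it lies on the original edge. -/
lemma mem_contractRootEdge_iff {ends : E → Sym2 V} {r y b : V} (hbr : b ≠ r) (hby : b ≠ y) (g : E) :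
    b ∈ contractRootEdge ends r y g ↔ b ∈ ends g := by
  rw [contractRootEdge, contractEnds_apply, Sym2.mem_map]
  constructor
  · rintro ⟨v, hv, hvb⟩
    by_cases hvW : v ∈ ({r, y} : Finset V)
    · rw [contractMap_of_mem hvW] at hvb
      exact absurd hvb.symm hbr
    · rw [contractMap_of_notMem hvW] at hvb
      exact hvb ▸ hv
  · intro hb
    exact ⟨b, hb, contractMap_of_notMem (by simp [hbr, hby])⟩

end Contract

section Theorems

variable {V : Type*} {E : Type*} [Fintype E] [DecidableEq E] [Fintype V] [DecidableEq V]
  {R : Type*} [Field R] [LinearOrder R] [IsStrictOrderedRing R]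

variable (p : E → R) (ends : E → Sym2 V) (o a₂ c b u : V)

omit [Fintype E] in
/-- The series weights are admissible. -/
lemma isProbVec_series (hp : IsProbVec p) (e f : E) :
    IsProbVec (Function.update (Function.update p f (p e * p f)) e 0) :=
  (hp.update f (mul_nonneg (hp.nonneg e) (hp.nonneg f))
    (by nlinarith [hp.nonneg e, hp.nonneg f, hp.le_one e, hp.le_one f])).update e le_rfl zero_le_one

/-- **(G4-u) on the coin class through a series vertex at `u`**: `b` carries exactly the edges
`f₁ = {b, a₂}` and `e₁ = {x, b}`, and the unmarked `x` carries exactly the non-loop edges `e₂ = {u, x}`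
and `e₁`; then (HCOV) at `(o, a₁, a₂, c, b)` for `a₁` pendant at `u` follows from (HCOV) at
`(o, u, a₂, c, b)`. -/
theorem HCov_root_leaf_u_of_coin_series_u (hp : IsProbVec p) {f : E} {a₁ : V} (hf : ends f = s(a₁, u))
    (hleaf : ∀ e, a₁ ∈ ends e → e = f) (h1u : a₁ ≠ u) (h12 : a₁ ≠ a₂) (h1c : a₁ ≠ c)
    (h1o : a₁ ≠ o) (h1b : a₁ ≠ b)
    {f₁ e₁ e₂ : E} {x : V} (hf₁ : ends f₁ = s(b, a₂)) (he₁ : ends e₁ = s(x, b)) (he₂ : ends e₂ = s(u, x))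
    (hb2 : ∀ e, b ∈ ends e → e = f₁ ∨ e = e₁)
    (hdeg : ∀ g, g ≠ e₂ → g ≠ e₁ → x ∈ ends g → (ends g).IsDiag)
    (hxo : x ≠ o) (hxu : x ≠ u) (hx2 : x ≠ a₂) (hxc : x ≠ c) (hxb : x ≠ b) (he12 : e₂ ≠ e₁)
    (hf1e1 : f₁ ≠ e₁) (hba : b ≠ a₂) (hbu : b ≠ u) (hbo : b ≠ o) (hbc : b ≠ c)
    (h3 : HCov p ends o u a₂ c b) : HCov p ends o a₁ a₂ c b := by
  refine HCov_root_leaf_u_of p ends hp hf hleaf h1u h12 h1c h1o h1b ?_ h3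
  rw [T2_series p he₂ he₁ he12 hxu.symm hxb hxo hxu hx2 hxc hxb hdeg]
  have hf₁' : contractRootEdge ends u x f₁ = s(b, a₂) := by
    rw [contractRootEdge_of_notMem (by rw [hf₁]; exact notMem_mk_of_ne hxb hx2), hf₁]
  have he₁' : contractRootEdge ends u x e₁ = s(b, u) := by
    rw [contractRootEdge_eq_of_eq he₁ hbu hxb.symm, Sym2.eq_swap]
  have hb2' : ∀ e, b ∈ contractRootEdge ends u x e → e = f₁ ∨ e = e₁ := fun e he =>
    hb2 e ((mem_contractRootEdge_iff hbu hxb.symm e).1 he)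
  exact T2_nonneg_coin _ _ o a₂ c b u (isProbVec_series p hp e₂ e₁) hf₁' he₁' hb2' hba hbu hf1e1 hbo hbc

/-- **(G4-u) on the coin class through a series vertex at `a₂`**: `b` carries exactly the edges
`f₂ = {b, u}` and `e₁ = {x, b}`, and the unmarked `x` carries exactly the non-loop edges `e₂ = {a₂, x}`
and `e₁`; then (HCOV) at `(o, a₁, a₂, c, b)` for `a₁` pendant at `u` follows from (HCOV) at
`(o, u, a₂, c, b)`. -/
theorem HCov_root_leaf_u_of_coin_series_a2 (hp : IsProbVec p) {f : E} {a₁ : V} (hf : ends f = s(a₁, u))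
    (hleaf : ∀ e, a₁ ∈ ends e → e = f) (h1u : a₁ ≠ u) (h12 : a₁ ≠ a₂) (h1c : a₁ ≠ c)
    (h1o : a₁ ≠ o) (h1b : a₁ ≠ b)
    {f₂ e₁ e₂ : E} {x : V} (hf₂ : ends f₂ = s(b, u)) (he₁ : ends e₁ = s(x, b)) (he₂ : ends e₂ = s(a₂, x))
    (hb2 : ∀ e, b ∈ ends e → e = e₁ ∨ e = f₂)
    (hdeg : ∀ g, g ≠ e₂ → g ≠ e₁ → x ∈ ends g → (ends g).IsDiag)
    (hxo : x ≠ o) (hxu : x ≠ u) (hx2 : x ≠ a₂) (hxc : x ≠ c) (hxb : x ≠ b) (he12 : e₂ ≠ e₁)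
    (he1f2 : e₁ ≠ f₂) (hba : b ≠ a₂) (hbu : b ≠ u) (hbo : b ≠ o) (hbc : b ≠ c)
    (h3 : HCov p ends o u a₂ c b) : HCov p ends o a₁ a₂ c b := by
  refine HCov_root_leaf_u_of p ends hp hf hleaf h1u h12 h1c h1o h1b ?_ h3
  rw [T2_series p he₂ he₁ he12 hx2.symm hxb hxo hxu hx2 hxc hxb hdeg]
  have he₁' : contractRootEdge ends a₂ x e₁ = s(b, a₂) := by
    rw [contractRootEdge_eq_of_eq he₁ hba hxb.symm, Sym2.eq_swap]
  have hf₂' : contractRootEdge ends a₂ x f₂ = s(b, u) := by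
    rw [contractRootEdge_of_notMem (by rw [hf₂]; exact notMem_mk_of_ne hxb hxu), hf₂]
  have hb2' : ∀ e, b ∈ contractRootEdge ends a₂ x e → e = e₁ ∨ e = f₂ := fun e he =>
    hb2 e ((mem_contractRootEdge_iff hba hxb.symm e).1 he)
  exact T2_nonneg_coin _ _ o a₂ c b u (isProbVec_series p hp e₂ e₁) he₁' hf₂' hb2' hba hbu he1f2 hbo hbc

end Theorems

end Coin

end RootLeafU

end Summit.Ventures.PercRepro2
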